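import Summits.CriticalPhenomena.Ising3DConformalLimit.Theorems.FKFourConnectivity.Negative.EdwardsSokalFour
import Literature.Probability.LatticeModels.IsingTransport
import Literature.Probability.LatticeModels.CriticalTwoPointBounds

/-!
# `FKFourConnectivity` — negative-side lemmas, III: the crux is necessary for the route's lattice bound

Split of the standing disprover's work file
`Summits/CriticalPhenomena/Ising3DConformalLimit/Cruxes/FKFourConnectivity/Disproof.lean`
(crux `stmt-CriticalPhenomena-11254`, route `FKParityRobustness`). Nothing here asserts the crux.

* `not_FKFourConnectivity_imp_not_latticeBound`: the crux is NECESSARY for the conclusion of the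
  route's `LatticeBoundFromFK` (= the hypothesis of `FarMergingGivesU4` at the tetrahedral shape):
  `¬FKFourConnectivity → ¬(∃ c > 0, ∀ l ≥ 1, U₄^crit(l·tetra) ≤ −c⟨σσ⟩_{β_c}⟨σσ⟩_{β_c})`.
  Chain: an infinite-volume bound passes to all large free boxes with constant `c/8`
  (`eventually_box_bound_of_latticeBound`: box limits at `β_c`, `criticalCorr_wellDefined_holds` /
  `tendsto_connectedFour_box_criticalBeta`, and positivity of `⟨σσ⟩_{β_c}`,
  `criticalTwoPoint_bounds_holds`); the free Ising model of the box graph on its whole vertex set is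
  the free Ising model of `ℤ³` in the box (`isingExpect_free_map`; `connectedFour_boxGraph`,
  `isingTwoPoint_boxGraph`); then Edwards–Sokal and `|U₄| ≤ 2P₄` (Part II) give the crux's
  inequality. So refuting the crux moots every pointwise-tetrahedral attack on clause (iii) — the
  planner's KILL CRITERIA as a theorem — and the crux is the weakest statement on that line.

## References

* M. Aizenman, Comm. Math. Phys. 86 (1982) 1–48, Prop. 5.3 [AizenmanCMP1982].
* M. Aizenman, H. Duminil-Copin, V. Sidoravicius, Comm. Math. Phys. 334 (2015), Thm. 1.1
  [AizenmanDuminilCopinSidoraviciusCMP2015].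
* S. Friedli, Y. Velenik, *Statistical Mechanics of Lattice Systems* (CUP 2017), §3.1 [FriedliVelenik2017].
-/

namespace Summit.CriticalPhenomena.Ising3DConformalLimit.Theorems.FKFourConnectivity.Negative

open MeasureTheory Finset
open Literature.Probability.LatticeModels Literature.Probability.Percolation

noncomputable section

section LatticeNecessity

open scoped Classical

open Filter Topology

/-- `univ.map val = Λ_N`: the whole vertex set of the box graph is the box. [folklore] -/
theorem univ_map_subtype_box (N : ℕ) :
    (Finset.univ : Finset ↥(box 3 N)).map (Function.Embedding.subtype _) = box 3 N := by
  rw [Finset.univ_eq_attach, Finset.attach_map_val]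

/-- The box graph is the graph induced by `ℤ³` on `Λ_N` (adjacency transported along `val`). [folklore] -/
theorem boxGraph_adj_iff (N : ℕ) :
    ∀ x ∈ (Finset.univ : Finset ↥(box 3 N)), ∀ y ∈ (Finset.univ : Finset ↥(box 3 N)),
      ((zdGraph 3).Adj ((Function.Embedding.subtype (· ∈ box 3 N)) x)
        ((Function.Embedding.subtype (· ∈ box 3 N)) y) ↔ ((zdGraph 3).comap (Subtype.val : ↥(box 3 N) → Site 3)).Adj x y) :=
  fun _ _ _ _ => Iff.rfl

/-- Transport of two-point functions: the free Ising model of the box graph on its whole vertex set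
is the free Ising model of `ℤ³` in the box. [cite: FriedliVelenik2017, §3.1, Def. 3.1] -/
theorem isingTwoPoint_boxGraph (N : ℕ) (β : ℝ) (x y : ↥(box 3 N)) :
    isingTwoPoint ((zdGraph 3).comap (Subtype.val : ↥(box 3 N) → Site 3)) univ β 0 .free x y =
      isingTwoPoint (zdGraph 3) (box 3 N) β 0 .free (x : Site 3) (y : Site 3) := by
  have h := isingTwoPoint_free_map (G := ((zdGraph 3).comap (Subtype.val : ↥(box 3 N) → Site 3))) (G' := zdGraph 3)
    (Function.Embedding.subtype (· ∈ box 3 N)) (Λ := univ) (boxGraph_adj_iff N) β 0 x y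
  rw [univ_map_subtype_box] at h
  exact h.symm

/-- Transport of spin-monomial expectations along `val`. [cite: FriedliVelenik2017, §3.1, Def. 3.1] -/
theorem isingExpect_spinMonomial_boxGraph (N : ℕ) (β : ℝ) {n : ℕ} (a : Fin n → ↥(box 3 N)) :
    isingExpect ((zdGraph 3).comap (Subtype.val : ↥(box 3 N) → Site 3)) univ β 0 .free (spinMonomial a) =
      isingExpect (zdGraph 3) (box 3 N) β 0 .free (spinMonomial (fun i => (a i : Site 3))) := by
  have h := isingExpect_free_map (G := ((zdGraph 3).comap (Subtype.val : ↥(box 3 N) → Site 3))) (G' := zdGraph 3)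
    (Function.Embedding.subtype (· ∈ box 3 N)) (Λ := univ) (boxGraph_adj_iff N) β 0
    (measurable_spinMonomial (fun i => (a i : Site 3)))
  rw [univ_map_subtype_box] at h
  rw [h]
  congr 1
  funext σ
  have hx : ∀ x : ↥(box 3 N), spinAt (x : Site 3)
      (SpinConfig.extendAlong (Function.Embedding.subtype (· ∈ box 3 N)) σ) = spinAt x σ :=
    fun x => spinAt_extendAlong _ σ x
  simp only [spinMonomial, hx]

/-- Transport of the four-point Ursell function along `val`. [cite: FriedliVelenik2017, §3.1, Def. 3.1] -/
theorem connectedFour_boxGraph (N : ℕ) (β : ℝ) (a : Fin 4 → ↥(box 3 N)) :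
    connectedFour (isingMeasure ((zdGraph 3).comap (Subtype.val : ↥(box 3 N) → Site 3)) univ β 0 .free) spinAt a =
      connectedFour (isingMeasure (zdGraph 3) (box 3 N) β 0 .free) spinAt (fun i => (a i : Site 3)) := by
  have h4 : nPoint (isingMeasure ((zdGraph 3).comap (Subtype.val : ↥(box 3 N) → Site 3)) univ β 0 .free) spinAt a =
      nPoint (isingMeasure (zdGraph 3) (box 3 N) β 0 .free) spinAt (fun i => (a i : Site 3)) :=
    isingExpect_spinMonomial_boxGraph N β a
  have h2 : ∀ x y : ↥(box 3 N), twoPoint (isingMeasure ((zdGraph 3).comap (Subtype.val : ↥(box 3 N) → Site 3)) univ β 0 .free) spinAt x y =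
      twoPoint (isingMeasure (zdGraph 3) (box 3 N) β 0 .free) spinAt (x : Site 3) (y : Site 3) :=
    fun x y => isingTwoPoint_boxGraph N β x y
  simp only [connectedFour, h4, h2]

/-- The analytic step: at a fixed injective lattice quadruple `y`, an infinite-volume bound
`U₄^crit(y) ≤ −c·G(y₀,y₁)G(y₂,y₃)` passes to all large free boxes with constant `c/8`
(box limits `criticalCorr_wellDefined_holds`, positivity of the critical two-point function from
`criticalTwoPoint_bounds_holds`). [cite: AizenmanDuminilCopinSidoraviciusCMP2015, Thm. 1.1] -/
theorem eventually_box_bound_of_latticeBound (y : Fin 4 → Site 3) (hy : Function.Injective y)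
    (c : ℝ) (hc : 0 < c)
    (hb : criticalCorr 3 4 y - (criticalCorr 3 2 ![y 0, y 1] * criticalCorr 3 2 ![y 2, y 3]
        + criticalCorr 3 2 ![y 0, y 2] * criticalCorr 3 2 ![y 1, y 3]
        + criticalCorr 3 2 ![y 0, y 3] * criticalCorr 3 2 ![y 1, y 2]) ≤
      -(c * (criticalCorr 3 2 ![y 0, y 1] * criticalCorr 3 2 ![y 2, y 3]))) :
    ∃ N₀ : ℕ, ∀ N : ℕ, N₀ ≤ N →
      c / 8 * (isingTwoPoint (zdGraph 3) (box 3 N) (criticalBeta 3) 0 .free (y 0) (y 1) *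
          isingTwoPoint (zdGraph 3) (box 3 N) (criticalBeta 3) 0 .free (y 2) (y 3)) ≤
        -(connectedFour (isingMeasure (zdGraph 3) (box 3 N) (criticalBeta 3) 0 .free) spinAt y) / 2 := by
  classical
  have hU := tendsto_connectedFour_box_criticalBeta (d := 3) le_rfl y
  have hmem : (BoundaryCondition.free : BoundaryCondition (Site 3)) ∈
      ({.free, .plus, .minus} : Set (BoundaryCondition (Site 3))) := by simp
  have hT : ∀ i j : Fin 4, Tendsto (fun L : ℕ => isingTwoPoint (zdGraph 3) (box 3 L) (criticalBeta 3) 0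
      .free (y i) (y j)) atTop (𝓝 (criticalCorr 3 2 ![y i, y j])) := by
    intro i j
    have h := criticalCorr_wellDefined_holds (d := 3) le_rfl 2 ![y i, y j] .free hmem
    refine Tendsto.congr (fun L => ?_) h
    simp only [isingTwoPoint, spinMonomial_two]
  have hGpos : ∀ i j : Fin 4, i ≠ j → 0 < criticalCorr 3 2 ![y i, y j] := by
    intro i j hij
    rw [criticalCorr_two_pair]
    obtain ⟨c₀, C₀, hc₀, hbd⟩ := criticalTwoPoint_bounds_holds (d := 3) le_rfl
    have hne : y j - y i ≠ 0 := sub_ne_zero.2 fun h => hij (hy h).symm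
    have hnorm : 0 < (‖y j - y i‖ : ℝ) := norm_pos_iff.2 hne
    exact lt_of_lt_of_le (mul_pos hc₀ (Real.rpow_pos_of_pos hnorm _)) (hbd (y j - y i) hne).1
  have hPpos : 0 < criticalCorr 3 2 ![y 0, y 1] * criticalCorr 3 2 ![y 2, y 3] :=
    mul_pos (hGpos 0 1 (by decide)) (hGpos 2 3 (by decide))
  have h02 : 0 ≤ criticalCorr 3 2 ![y 0, y 2] * criticalCorr 3 2 ![y 1, y 3] :=
    mul_nonneg (criticalCorr_two_nonneg _ _) (criticalCorr_two_nonneg _ _)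
  have h03 : 0 ≤ criticalCorr 3 2 ![y 0, y 3] * criticalCorr 3 2 ![y 1, y 2] :=
    mul_nonneg (criticalCorr_two_nonneg _ _) (criticalCorr_two_nonneg _ _)
  set P := criticalCorr 3 2 ![y 0, y 1] * criticalCorr 3 2 ![y 2, y 3] with hP
  have ev1 : ∀ᶠ L : ℕ in atTop, connectedFour (isingMeasure (zdGraph 3) (box 3 L) (criticalBeta 3) 0 .free)
      spinAt y < -(c * P / 2) :=
    (tendsto_order.1 hU).2 _ (by nlinarith)
  have ev2 : ∀ᶠ L : ℕ in atTop, isingTwoPoint (zdGraph 3) (box 3 L) (criticalBeta 3) 0 .free (y 0) (y 1) *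
      isingTwoPoint (zdGraph 3) (box 3 L) (criticalBeta 3) 0 .free (y 2) (y 3) < 2 * P :=
    (tendsto_order.1 ((hT 0 1).mul (hT 2 3))).2 _ (by linarith)
  obtain ⟨N₀, hN₀⟩ := Filter.eventually_atTop.1 (ev1.and ev2)
  refine ⟨N₀, fun N hN => ?_⟩
  obtain ⟨h1, h2⟩ := hN₀ N hN
  nlinarith

/-- **The crux is necessary for the route's lattice bound** (kernel-checked kill criterion): if
`FKFourConnectivity` fails then the conclusion of the route's `LatticeBoundFromFK` — the hypothesis
of `FarMergingGivesU4` at the tetrahedral shape, `U₄^crit(A_l) ≤ −c·⟨σσ⟩⟨σσ⟩` for all `l ≥ 1` — is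
FALSE. Chain: lattice bound ⇒ (box limits at `β_c`, positivity of `⟨σσ⟩_{β_c}`) the same bound in
large free boxes with `c/8` ⇒ (transport to the box graph, Edwards–Sokal, `|U₄| ≤ 2P₄`) the crux.
So refuting the crux moots EVERY pointwise-tetrahedral attack on clause (iii), exactly as the
planner's KILL CRITERIA say; equivalently the crux is the weakest statement on that line.
[cite: AizenmanCMP1982, Prop. 5.3] -/
theorem not_FKFourConnectivity_imp_not_latticeBound
    (hn : ¬ Summit.CriticalPhenomena.Ising3DConformalLimit.Theses.FKParityRobustness.FKFourConnectivity) :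
    ¬ (∃ c : ℝ, 0 < c ∧ ∀ l : ℕ, 1 ≤ l →
        criticalCorr 3 4 (fun i => (l : ℤ) • (![![-1, -1, -1], ![1, 1, -1], ![1, -1, 1], ![-1, 1, 1]] : Fin 4 → Site 3) i) -
          (criticalCorr 3 2 ![(l : ℤ) • (![![-1, -1, -1], ![1, 1, -1], ![1, -1, 1], ![-1, 1, 1]] : Fin 4 → Site 3) 0, (l : ℤ) • (![![-1, -1, -1], ![1, 1, -1], ![1, -1, 1], ![-1, 1, 1]] : Fin 4 → Site 3) 1] * criticalCorr 3 2 ![(l : ℤ) • (![![-1, -1, -1], ![1, 1, -1], ![1, -1, 1], ![-1, 1, 1]] : Fin 4 → Site 3) 2, (l : ℤ) • (![![-1, -1, -1], ![1, 1, -1], ![1, -1, 1], ![-1, 1, 1]] : Fin 4 → Site 3) 3]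
          + criticalCorr 3 2 ![(l : ℤ) • (![![-1, -1, -1], ![1, 1, -1], ![1, -1, 1], ![-1, 1, 1]] : Fin 4 → Site 3) 0, (l : ℤ) • (![![-1, -1, -1], ![1, 1, -1], ![1, -1, 1], ![-1, 1, 1]] : Fin 4 → Site 3) 2] * criticalCorr 3 2 ![(l : ℤ) • (![![-1, -1, -1], ![1, 1, -1], ![1, -1, 1], ![-1, 1, 1]] : Fin 4 → Site 3) 1, (l : ℤ) • (![![-1, -1, -1], ![1, 1, -1], ![1, -1, 1], ![-1, 1, 1]] : Fin 4 → Site 3) 3]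
          + criticalCorr 3 2 ![(l : ℤ) • (![![-1, -1, -1], ![1, 1, -1], ![1, -1, 1], ![-1, 1, 1]] : Fin 4 → Site 3) 0, (l : ℤ) • (![![-1, -1, -1], ![1, 1, -1], ![1, -1, 1], ![-1, 1, 1]] : Fin 4 → Site 3) 3] * criticalCorr 3 2 ![(l : ℤ) • (![![-1, -1, -1], ![1, 1, -1], ![1, -1, 1], ![-1, 1, 1]] : Fin 4 → Site 3) 1, (l : ℤ) • (![![-1, -1, -1], ![1, 1, -1], ![1, -1, 1], ![-1, 1, 1]] : Fin 4 → Site 3) 2]) ≤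
        -(c * (criticalCorr 3 2 ![(l : ℤ) • (![![-1, -1, -1], ![1, 1, -1], ![1, -1, 1], ![-1, 1, 1]] : Fin 4 → Site 3) 0, (l : ℤ) • (![![-1, -1, -1], ![1, 1, -1], ![1, -1, 1], ![-1, 1, 1]] : Fin 4 → Site 3) 1] *
          criticalCorr 3 2 ![(l : ℤ) • (![![-1, -1, -1], ![1, 1, -1], ![1, -1, 1], ![-1, 1, 1]] : Fin 4 → Site 3) 2, (l : ℤ) • (![![-1, -1, -1], ![1, 1, -1], ![1, -1, 1], ![-1, 1, 1]] : Fin 4 → Site 3) 3]))) := by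
  rintro ⟨c, hc, hb⟩
  apply hn
  refine ⟨c / 8, by positivity, fun l hl => ?_⟩
  have hβ : 0 ≤ criticalBeta 3 := criticalBeta_nonneg 3
  -- injectivity of the pinned quadruple
  have hinj : Function.Injective (fun i : Fin 4 => (l : ℤ) • (![![-1, -1, -1], ![1, 1, -1], ![1, -1, 1], ![-1, 1, 1]] : Fin 4 → Site 3) i) := by
    intro i j hij
    by_contra hne
    have hl0 : (l : ℤ) ≠ 0 := by exact_mod_cast Nat.one_le_iff_ne_zero.1 hl
    have key : (![![-1, -1, -1], ![1, 1, -1], ![1, -1, 1], ![-1, 1, 1]] : Fin 4 → Site 3) i = (![![-1, -1, -1], ![1, 1, -1], ![1, -1, 1], ![-1, 1, 1]] : Fin 4 → Site 3) j := by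
      funext k
      have := congrFun hij k
      simp only [Pi.smul_apply, smul_eq_mul] at this
      exact mul_left_cancel₀ hl0 this
    fin_cases i <;> fin_cases j <;> first | exact hne rfl | (have := congrFun key 0; have := congrFun key 1; simp at *)
  obtain ⟨N₀, hN₀⟩ := eventually_box_bound_of_latticeBound (fun i => (l : ℤ) • (![![-1, -1, -1], ![1, 1, -1], ![1, -1, 1], ![-1, 1, 1]] : Fin 4 → Site 3) i) hinj c hc (hb l hl)
  refine ⟨N₀, fun N hN a ha => ?_⟩
  have hbox := hN₀ N hN
  have hay : (fun i => (a i : Site 3)) = fun i => (l : ℤ) • (![![-1, -1, -1], ![1, 1, -1], ![1, -1, 1], ![-1, 1, 1]] : Fin 4 → Site 3) i := funext ha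
  -- the crux's quantities, transported to `ℤ³` in the box
  have tU := connectedFour_boxGraph N (criticalBeta 3) a
  have t01 := isingTwoPoint_boxGraph N (criticalBeta 3) (a 0) (a 1)
  have t23 := isingTwoPoint_boxGraph N (criticalBeta 3) (a 2) (a 3)
  rw [hay] at tU
  rw [ha 0, ha 1] at t01
  rw [ha 2, ha 3] at t23
  have hs := neg_two_mul_allJoined_le_connectedFour ((zdGraph 3).comap (Subtype.val : ↥(box 3 N) → Site 3)) hβ a
  have e01 : isingTwoPoint ((zdGraph 3).comap (Subtype.val : ↥(box 3 N) → Site 3)) univ (criticalBeta 3) 0 .free (a 0) (a 1) =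
      (rcMeasure ((zdGraph 3).comap (Subtype.val : ↥(box 3 N) → Site 3)) (fkIsingParam (criticalBeta 3)) 2 ∅).real (openConn (a 0) (a 1)) :=
    edwardsSokal_twoPoint_holds ((zdGraph 3).comap (Subtype.val : ↥(box 3 N) → Site 3)) hβ (a 0) (a 1)
  have e23 : isingTwoPoint ((zdGraph 3).comap (Subtype.val : ↥(box 3 N) → Site 3)) univ (criticalBeta 3) 0 .free (a 2) (a 3) =
      (rcMeasure ((zdGraph 3).comap (Subtype.val : ↥(box 3 N) → Site 3)) (fkIsingParam (criticalBeta 3)) 2 ∅).real (openConn (a 2) (a 3)) :=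
    edwardsSokal_twoPoint_holds ((zdGraph 3).comap (Subtype.val : ↥(box 3 N) → Site 3)) hβ (a 2) (a 3)
  change c / 8 * (rcMeasure ((zdGraph 3).comap (Subtype.val : ↥(box 3 N) → Site 3)) (fkIsingParam (criticalBeta 3)) 2 ∅).real (openConn (a 0) (a 1)) *
      (rcMeasure ((zdGraph 3).comap (Subtype.val : ↥(box 3 N) → Site 3)) (fkIsingParam (criticalBeta 3)) 2 ∅).real (openConn (a 2) (a 3)) ≤ (rcMeasure ((zdGraph 3).comap (Subtype.val : ↥(box 3 N) → Site 3)) (fkIsingParam (criticalBeta 3)) 2 ∅).real {ω | ∀ i j, (openGraph ω).Reachable (a i) (a j)}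
  change -(2 * (rcMeasure ((zdGraph 3).comap (Subtype.val : ↥(box 3 N) → Site 3)) (fkIsingParam (criticalBeta 3)) 2 ∅).real {ω | ∀ i j, (openGraph ω).Reachable (a i) (a j)}) ≤ _ at hs
  rw [← e01, ← e23, t01, t23]
  rw [tU] at hs
  beta_reduce at hbox
  nlinarith [hbox, hs]

end LatticeNecessity

end

end Summit.CriticalPhenomena.Ising3DConformalLimit.Theorems.FKFourConnectivity.Negative
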